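import Summits.QuantumFields.YangMills.Theorems.BalabanUVNodesK0S5CollarCubeDomains
import Summits.QuantumFields.YangMills.Theorems.UnitScaleTiltProp8HalvingQuarterCubeSeq
import Literature.MathematicalPhysics.QuantumFieldTheory.Balaban1983to89.Node00.TorusCoverCubeMemberPrint
import Literature.MathematicalPhysics.QuantumFieldTheory.Balaban1983to89.T4AxialGaugeSmallField
import HarnessLib

/-!
# K0⁷ `stub_prop8StepCoP13` (stmt-QuantumFields-20541), sub-target S5 — **THE NEAR SLOT (160) OF THE `HB` ROWS AT THE TOWER `Node00.cubeDomains`: the top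
# territory `Λ_k` lies in the data's coarse axial-gauge BOX `[□_k^{(k)} − 𝟙, □_k^{(k)} + 𝟙]`, so a UNIFORM size of the datum on that box's bonds is the near hypothesis
# `‖B c‖ ≤ s·(distBI(b, c) + 1)` of P12 ∕ of the S6 `HB` theorem; the box's side and non-wrapping at the print datum from the torus-size floor**

Cell `pub-ymgap`, width seat `pub-ymgap-k0-s1-w3` gen 4 (D-0149; START LIST v10 §k0-s1; bus CLAIM-2∕INTENT-2 2026-08-28).  `--kind proof --supports
stmt-QuantumFields-20541 --as helper`; count-neutral; def-free.

WHY.  [Balaban1985Variational] p. 303 derives the NEAR size (160) of the datum `B` on the top territory from the data's generalized axial gauge on `□̃_k^{(k)}`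
(«V′₁ satisfies the generalized axial gauge conditions on □̃_k^{(k)} with a center at the point y, hence |V′₁(x, x′) − 1| < |x − y|2L²ε₁»).  At the record, dag-n07-e
g19's `N07DataAxialTopBox` (INTENT-40) supplies the re-gauged data `V^h`, `h :=` pv26's `T4AxialGaugeSmallField.axialGauge V lo hi` of a non-wrapping coarse box
`[lo, hi] ⊂ T^{(k)}`, with the UNIFORM size `‖β (V^h b)‖ ≤ C·(d − 1)·n·δ` on the box bonds `b ∈ boxBonds lo hi` (`hi ≤ lo + n`, `n < sitesPerDir k`); the S6 `HB`
theorem (dag-n07-w4 `letters10On_HB_cubeDomains_box`, over this seat's P12 `hbRows164_core_of_adm22_T4`) asks instead, for the TOP cells `c` (`j(c) = k`) of the index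
set `𝔅` of `D := Node00.cubeDomains P a M ρ k hk`, the near hypothesis `‖B c‖ ≤ C_d·M_Δ·ε₁·(distBI D b c + 1)`.  THIS FILE is the junction (dag-n07-e g19 → k0-s1-w3,
INBOX l.28912: «the near-slot sizes of your P12 for the UNSHEARED datum»): (§1) every top-territory bond of `D` — a level-`k` bond with an end-point in
`Ω_k^{(k)} = π_k '' □_k^{(k)}`, `□_k^{(k)} = [a − ρ, a + M − 1 + ρ]` — is a box bond of the coarse box ENLARGED BY ONE, `lo := □_k^{(k)}.lo − 𝟙`, `hi := □_k^{(k)}.hi + 𝟙`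
(the bonds entering `□_k^{(k)}` from below start one label outside it); (§2) hence a uniform size `s` on those box bonds is the near hypothesis with constant `s`
(`distBI ≥ 0`, ym3-torus's `HalvingQuarterCubeSeq.distBI_nonneg`); (§3) the box has side `n = M + 2ρ + 2` in the binder shape `hi ≤ lo + n` and does not wrap,
`n < sitesPerDir k`, under the torus-size floor `M + 4ρ ≤ sitesPerDir k` of this seat's `K0S5CollarNumerics` (`ρ ≥ 2`), and at the print datum `propCubeP` under its floor
`M + 11d + 6ρ ≤ sitesPerDir n`.

WHAT IS PROVED (sorry-free; axioms standard; no definition; lattice bookkeeping only — NO estimate of Bałaban).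
§1 ★★ `mem_boxBonds_of_lamBond` (EVERY level `1 ≤ j ≤ k`: `D.LamBond j b ⇒ b ∈ boxBonds (□_j^{(j)}.lo − 𝟙) (□_j^{(j)}.hi + 𝟙)`; both star cases of
   [Balaban1984PropagatorsII] (2.3): source in the box, or target in the box and source one step below — the far levels serve the (155) slot the same way) ·
   ★★ `mem_boxBonds_of_lamBond_top` (the level `j = k`).
§2 ★★★ `norm_le_mul_distBI_add_one_of_top` (ANY seminormed datum `B : 𝔅_D → E`, `s ≥ 0`: a uniform size on the top cells whose bond is a box bond ⇒
   `∀ b, ∀ c top, ‖B c‖ ≤ s·(distBI D b c + 1)` — the `hnear` binder of P12 ∕ of `letters10On_HB_cubeDomains_box` with `C_d·M_Δ·ε₁ := s`) ·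
   `abs_le_mul_distBI_add_one_of_top` (the real-datum form of P12's `hbRows164_core_of_adm22_T4`) · ★★ `norm_le_mul_distBI_add_one_of_topFun` (cast-free form: the top
   datum given as a function `Btop` of the level-`k` bond, `‖Btop b‖ ≤ s` on the box bonds — dag-n07-e's output shape — ⇒ the near hypothesis).
§3 `levelBox_hi_le_lo_add` ∕ `levelBox_side_lt_sitesPerDir` (level `j`: side `L^{k−j}M + 2ρ·gs L (k−j) + 2 < sitesPerDir j` under `M + 4ρ ≤ sitesPerDir k`, `ρ ≥ 2`) ·
   `topBox_hi_le_lo_add` (`hi ≤ lo + (M + 2ρ + 2)`) · `topBox_side_lt_sitesPerDir` (`M + 4ρ ≤ sitesPerDir k`, `2 ≤ ρ` ⇒ `M + 2ρ + 2 < sitesPerDir k`) ·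
   ★ `topBox_propCubeP` (at `c := propCubeP P n hn M ρ hρ idx`: `hi ≤ lo + (c.M + 2ρ + 2)` and `c.M + 2ρ + 2 < sitesPerDir n` under `M + 11d + 6ρ ≤ sitesPerDir n`)
   — dag-n07-e's binders `hn` ∕ `hnN` of `exists_dataAxial_topBox` ∕ `norm_datum_dataAxial_le` at this box, BY SHAPE.
HONEST SCOPE: geometry of the top level of the tower (144) only; the datum `B`, the re-gauging, the (7)-smallness of the data on the box plaquettes, the log-like
map `β` and the far slot (155) are the data lane's ∕ the S6 head's (dag-n07-e `N07DataAxialTopBox`, dag-n07-w4); case II of (160) (crossing bonds, Lemma 1 of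
[Balaban1985RegularSpaces]) is not needed for a UNIFORM top size and is not touched; nothing of [Balaban1985Variational] asserted; stub 1 ∕ K0⁷ NOT closed; N07 NOT
discharged (5∕27 unmoved); one finite 𝕋⁴ programme at fixed ε — R4 closes the conditional finite-𝕋⁴ rung `BalabanLadder.UV` only; the YM mass gap (Clay) is NOT proved by
any of this; nothing continuum ∕ ℝ⁴ ∕ OS.  No `def`, no `instance`, no `notation`, no `sorry`.

References: T. Bałaban, CMP **102** (1985) 277–309 [Balaban1985Variational] (144) p.300, (147) p.301, (160)–(161) p.303; CMP **96** (1984) 223–250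
[Balaban1984PropagatorsII] (2.3) p.224; CMP **99** (1985) 75–102 [Balaban1985RegularSpaces] (1.131) p.99; CMP **109** (1987) 249–301 [Balaban1987RG1] (0.1) p.251.
-/

set_option autoImplicit false

noncomputable section

namespace Summit.QuantumFields.YangMills.Theorems.K0S5NearSlotTopBox

open Literature.MathematicalPhysics.QuantumFieldTheory.Balaban1983to89
open Literature.MathematicalPhysics.QuantumFieldTheory.Balaban1983to89.Node00
open B14DomainGeom (Pt)
open B7Prop1Explicit (e e_apply)
open B7Prop1Local (InBox)
open B8Eq131Cubes (sqLo sqHi bLo bHi gs)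
open B6SectADomainsV1 (Domains)
open B6SectAOperatorsV1 (BondIdx)
open T4AxialGaugeSmallField (boxBonds castSite castSite_add_e)
open Summit.QuantumFields.YangMills.Theorems.FlatCubeOpsText (distBI)
open Summit.QuantumFields.YangMills.Theorems.HalvingQuarterCubeSeq (distBI_nonneg)

variable {P : Params}

/-! ## §1  The top territory `Λ_k` of `cubeDomains` lies in the coarse box `[□_k^{(k)} − 𝟙, □_k^{(k)} + 𝟙]` -/

section TopTerritory

variable {a : Pt P.d} {M ρ k : ℕ} {hk : k ≤ P.m + P.K}

/-- ★★ **EVERY TERRITORY `Λ_j` (`1 ≤ j ≤ k`) IS MADE OF BOX BONDS OF ITS ENLARGED CUBE `□_j^{(j)} ± 𝟙`**: a level-`j` bond `b` of the territory `Λ_j` of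
`D := cubeDomains P a M ρ k hk` (an end-point in `Ω_j^{(j)} = π_j '' □_j^{(j)}`, [Balaban1984PropagatorsII] (2.3) star convention) is `⟨π_j x, μ⟩` for a label `x` with
`□_j^{(j)}.lo − 𝟙 ≤ x` and `x + e_μ ≤ □_j^{(j)}.hi + 𝟙` — if its source lies in the box take its label, if its target does, step the target's label back by `e_μ`
(pv26's `castSite_add_e` and the injectivity of `x ↦ x + e_μ`, `LatticeFieldCalculus.shiftEquiv`).  The far levels `j < k` serve the (155) slot the same way the top
level serves (160). [cite: Balaban1984PropagatorsII, (2.3) p.224; Balaban1985RegularSpaces, (1.131) p.99; Balaban1985Variational, (155) p.302, (160) p.303] -/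
theorem mem_boxBonds_of_lamBond {j : ℕ} (hj1 : 1 ≤ j) (hjk : j ≤ k) {b : PBond P j} (hb : (cubeDomains P a M ρ k hk).LamBond j b) :
    b ∈ boxBonds (fun i => sqLo P.L a ρ k j i - 1) (fun i => sqHi P.L a M ρ k j i + 1) := by
  obtain ⟨hst, -, -⟩ := hb
  rcases hst with hsrc | htgt
  · obtain ⟨s, hs, hse⟩ := (mem_cubeDomains_Om_iff hj1 hjk _).1 hsrc
    refine ⟨s, fun i => ?_, fun i => ?_, hse.symm⟩
    · have := (hs i).1
      linarith
    · have := (hs i).2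
      simp only [Pi.add_apply, e_apply]
      split_ifs <;> linarith
  · obtain ⟨s, hs, hse⟩ := (mem_cubeDomains_Om_iff hj1 hjk _).1 htgt
    refine ⟨s - e b.dir, fun i => ?_, fun i => ?_, ?_⟩
    · have := (hs i).1
      simp only [Pi.sub_apply, e_apply]
      split_ifs <;> linarith
    · have := (hs i).2
      simp only [Pi.add_apply, Pi.sub_apply, e_apply]
      split_ifs <;> linarith
    · have h1 : (castSite (s - e b.dir) : Site P j).shift b.dir = b.src.shift b.dir := by
        rw [← castSite_add_e, sub_add_cancel]
        exact hse
      exact ((LatticeFieldCalculus.shiftEquiv b.dir).injective h1).symm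

/-- ★★ **THE TOP TERRITORY IS MADE OF BOX BONDS OF THE ENLARGED TOP BOX** `[□_k^{(k)} − 𝟙, □_k^{(k)} + 𝟙]`, `□_k^{(k)} = [a − ρ, a + M − 1 + ρ]` — the level
`j = k` of `mem_boxBonds_of_lamBond`, stated at a level `j` with `j = k` because the index set `𝔅_D` carries its level as a `Fin`.
[cite: Balaban1984PropagatorsII, (2.3) p.224; Balaban1985RegularSpaces, (1.131) p.99; Balaban1985Variational, (160) p.303] -/
theorem mem_boxBonds_of_lamBond_top (hk1 : 1 ≤ k) {j : ℕ} (hj : j = k) {b : PBond P j} (hb : (cubeDomains P a M ρ k hk).LamBond j b) :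
    b ∈ boxBonds (fun i => sqLo P.L a ρ k k i - 1) (fun i => sqHi P.L a M ρ k k i + 1) := by
  subst hj
  exact mem_boxBonds_of_lamBond hk1 le_rfl hb

end TopTerritory

/-! ## §2  A uniform size on the box bonds is the near hypothesis of the `HB` rows -/

section NearSlot

variable {a : Pt P.d} {M ρ k : ℕ} {hk : k ≤ P.m + P.K}

/-- ★★★ **THE NEAR SLOT FROM A UNIFORM TOP SIZE**: for any seminormed datum `B` on the index set of `D := cubeDomains P a M ρ k hk` and `s ≥ 0`, if
`‖B c‖ ≤ s` for every TOP cell `c` (`j(c) = k`) whose bond is a box bond of the enlarged top box, then for every fine bond `b` and every top cell `c`,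
`‖B c‖ ≤ s·(distBI D b c + 1)` — the `hnear` binder of P12 ∕ of dag-n07-w4's `letters10On_HB_cubeDomains_box` with `C_d·M_Δ·ε₁ := s` (`distBI ≥ 0`; §1 supplies the
box membership). [cite: Balaban1985Variational, (160)–(161) p.303] -/
theorem norm_le_mul_distBI_add_one_of_top {E : Type*} [SeminormedAddCommGroup E] (hk1 : 1 ≤ k) {B : BondIdx (cubeDomains P a M ρ k hk) → E} {s : ℝ}
    (hs : 0 ≤ s)
    (hB : ∀ c : BondIdx (cubeDomains P a M ρ k hk), (c.1.1 : ℕ) = k →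
      c.1.2 ∈ boxBonds (fun i => sqLo P.L a ρ k k i - 1) (fun i => sqHi P.L a M ρ k k i + 1) → ‖B c‖ ≤ s) :
    ∀ b : PBond P 0, ∀ c : BondIdx (cubeDomains P a M ρ k hk), (c.1.1 : ℕ) = k → ‖B c‖ ≤ s * (distBI (cubeDomains P a M ρ k hk) b c + 1) := by
  intro b c hc
  have h1 := hB c hc (mem_boxBonds_of_lamBond_top hk1 hc c.2)
  have h0 := distBI_nonneg (cubeDomains P a M ρ k hk) b c
  nlinarith

/-- **The real-datum form** (the letters of P12's `hbRows164_core_of_adm22_T4`: `|X c| ≤ C_d·M_Δ·ε₁·(distBI D b c + 1)` on the top cells): a uniform `|X c| ≤ s` on the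
top cells whose bond is a box bond gives it with `C_d·M_Δ·ε₁ := s`. [cite: Balaban1985Variational, (160)–(161) p.303] -/
theorem abs_le_mul_distBI_add_one_of_top (hk1 : 1 ≤ k) {X : BondIdx (cubeDomains P a M ρ k hk) → ℝ} {s : ℝ} (hs : 0 ≤ s)
    (hX : ∀ c : BondIdx (cubeDomains P a M ρ k hk), (c.1.1 : ℕ) = k →
      c.1.2 ∈ boxBonds (fun i => sqLo P.L a ρ k k i - 1) (fun i => sqHi P.L a M ρ k k i + 1) → |X c| ≤ s) :
    ∀ b : PBond P 0, ∀ c : BondIdx (cubeDomains P a M ρ k hk), (c.1.1 : ℕ) = k → |X c| ≤ s * (distBI (cubeDomains P a M ρ k hk) b c + 1) := by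
  intro b c hc
  have h1 := hX c hc (mem_boxBonds_of_lamBond_top hk1 hc c.2)
  have h0 := distBI_nonneg (cubeDomains P a M ρ k hk) b c
  nlinarith

/-- ★★ **CAST-FREE FORM FOR A TOP DATUM GIVEN ON LEVEL-`k` BONDS**: if on the top cells the datum `B` is a function `Btop` of the cell's level-`k` bond (the index
set stores the level as a `Fin`, so the bond is transported along `j(c) = k`), and `‖Btop b‖ ≤ s` on the box bonds of the enlarged top box — the output shape of
dag-n07-e's `N07DataAxialTopBox.norm_datum_dataAxial_le` for `Btop b := β (V^h b)` — then the near hypothesis holds with constant `s`.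
[cite: Balaban1985Variational, (147) p.301, (160)–(161) p.303] -/
theorem norm_le_mul_distBI_add_one_of_topFun {E : Type*} [SeminormedAddCommGroup E] (hk1 : 1 ≤ k) {B : BondIdx (cubeDomains P a M ρ k hk) → E}
    (Btop : PBond P k → E) {s : ℝ} (hs : 0 ≤ s)
    (hBtop : ∀ b : PBond P k, b ∈ boxBonds (fun i => sqLo P.L a ρ k k i - 1) (fun i => sqHi P.L a M ρ k k i + 1) → ‖Btop b‖ ≤ s)
    (hBc : ∀ c : BondIdx (cubeDomains P a M ρ k hk), ∀ hc : (c.1.1 : ℕ) = k, B c = Btop (hc ▸ c.1.2)) :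
    ∀ b : PBond P 0, ∀ c : BondIdx (cubeDomains P a M ρ k hk), (c.1.1 : ℕ) = k → ‖B c‖ ≤ s * (distBI (cubeDomains P a M ρ k hk) b c + 1) := by
  refine norm_le_mul_distBI_add_one_of_top hk1 hs fun c hc hmem => ?_
  rw [hBc c hc]
  refine hBtop _ ?_
  obtain ⟨⟨⟨j, hj⟩, bb⟩, hbb⟩ := c
  simp only at hc
  subst hc
  exact hmem

end NearSlot

/-! ## §3  The side of the enlarged top box and its non-wrapping, at a generic cube and at the print datum -/

section Side

/-- The enlarged level-`j` box `□_j^{(j)} ± 𝟙` has side `L^{k−j}·M + 2ρ·gs L (k − j) + 2` in pv26's binder shape `hi κ ≤ lo κ + n`.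
[cite: Balaban1985RegularSpaces, (1.131) p.99 (bookkeeping)] -/
theorem levelBox_hi_le_lo_add (a : Pt P.d) (M ρ k j : ℕ) :
    ∀ κ : Fin P.d, (fun i => sqHi P.L a M ρ k j i + 1) κ ≤
      (fun i => sqLo P.L a ρ k j i - 1) κ + ((P.L ^ (k - j) * M + 2 * (ρ * gs P.L (k - j)) + 2 : ℕ) : ℤ) := by
  intro κ
  simp only [sqHi, sqLo, bHi, bLo]
  push_cast
  nlinarith [pow_nonneg (Nat.cast_nonneg (α := ℤ) P.L) (k - j)]

/-- The enlarged level-`j` box does not wrap under the torus-size floor at level `k` (`M + 4ρ ≤ sitesPerDir k`, `j ≤ k ≤ m + K`, `ρ ≥ 2`): its side is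
`< sitesPerDir j = L^{k−j}·sitesPerDir k` (`gs L (k − j) + 1 ≤ 2L^{k−j}`, `B8Ineq132.geom_margin`). [cite: Balaban1985RegularSpaces, p.98 («Σ R₁M₁Lʲη < (1 − L⁻¹)⁻¹R₁M₁ ≤ 2R₁M₁»); Balaban1987RG1, (0.1) p.251] -/
theorem levelBox_side_lt_sitesPerDir {M ρ k j : ℕ} (hjk : j ≤ k) (hk : k ≤ P.m + P.K) (hρ : 2 ≤ ρ) (hw : M + 4 * ρ ≤ P.sitesPerDir k) :
    P.L ^ (k - j) * M + 2 * (ρ * gs P.L (k - j)) + 2 < P.sitesPerDir j := by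
  have hL2 : 2 ≤ P.L := P.hL.2
  have hg : gs P.L (k - j) + 1 ≤ 2 * P.L ^ (k - j) := B8Ineq132.geom_margin hL2 (k - j)
  have hper : P.sitesPerDir j = P.L ^ (k - j) * P.sitesPerDir k := by
    unfold Params.sitesPerDir
    rw [mul_left_comm, ← pow_add]
    congr 2
    omega
  have hLpos : 1 ≤ P.L ^ (k - j) := Nat.one_le_pow _ _ P.L_pos
  rw [hper]
  have h1 : P.L ^ (k - j) * (M + 4 * ρ) ≤ P.L ^ (k - j) * P.sitesPerDir k := Nat.mul_le_mul_left _ hw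
  nlinarith

/-- The enlarged top box has side `M + 2ρ + 2` in pv26's binder shape: `hi κ ≤ lo κ + (M + 2ρ + 2)`. [cite: Balaban1985RegularSpaces, (1.131) p.99 (bookkeeping)] -/
theorem topBox_hi_le_lo_add (a : Pt P.d) (M ρ k : ℕ) :
    ∀ κ : Fin P.d, (fun i => sqHi P.L a M ρ k k i + 1) κ ≤ (fun i => sqLo P.L a ρ k k i - 1) κ + ((M + 2 * ρ + 2 : ℕ) : ℤ) := by
  intro κ
  simp only [sqHi, sqLo, bHi, bLo, Nat.sub_self, pow_zero, one_mul, B8Eq131Cubes.gs_zero, mul_one]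
  push_cast
  linarith

/-- The enlarged top box does not wrap under the torus-size floor of `K0S5CollarNumerics` (`M + 4ρ ≤ sitesPerDir k`, `ρ ≥ 2`): `M + 2ρ + 2 < sitesPerDir k`.
[cite: Balaban1987RG1, (0.1) p.251 (bookkeeping)] -/
theorem topBox_side_lt_sitesPerDir {M ρ k : ℕ} (hρ : 2 ≤ ρ) (hw : M + 4 * ρ ≤ P.sitesPerDir k) : M + 2 * ρ + 2 < P.sitesPerDir k := by
  omega

/-- ★ **AT THE PRINT DATUM** `c := propCubeP P n hn M ρ hρ idx` (36a: side `c.M = sideP ≤ M + 11d + 2ρ`, collar `ρ ≥ L`): the enlarged top box of its tower has side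
`c.M + 2ρ + 2` and does not wrap under the floor `M + 11d + 6ρ ≤ sitesPerDir n` — dag-n07-e's binders `hn`, `hnN` at this box. [cite: Balaban1985RegularSpaces, p.98; Balaban1987RG1, (0.1) p.251] -/
theorem topBox_propCubeP (n : ℕ) (hn : 1 ≤ n) (M ρ : ℕ) (hρ : P.L ≤ ρ) (idx : Pt P.d) (hw : M + 11 * P.d + 6 * ρ ≤ P.sitesPerDir n) :
    (∀ κ : Fin P.d,
      (fun i => sqHi P.L (propCubeP P n hn M ρ hρ idx).a (propCubeP P n hn M ρ hρ idx).M (propCubeP P n hn M ρ hρ idx).ρ n n i + 1) κ ≤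
        (fun i => sqLo P.L (propCubeP P n hn M ρ hρ idx).a (propCubeP P n hn M ρ hρ idx).ρ n n i - 1) κ +
          (((propCubeP P n hn M ρ hρ idx).M + 2 * ρ + 2 : ℕ) : ℤ)) ∧
    (propCubeP P n hn M ρ hρ idx).M + 2 * ρ + 2 < P.sitesPerDir n := by
  refine ⟨?_, ?_⟩
  · simpa only [propCubeP_ρ] using topBox_hi_le_lo_add (P := P) (propCubeP P n hn M ρ hρ idx).a (propCubeP P n hn M ρ hρ idx).M ρ n
  · have h1 := sideP_le (P := P) M ρ
    have hL := P.hL.2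
    simp only [propCubeP_M]
    omega

end Side

end Summit.QuantumFields.YangMills.Theorems.K0S5NearSlotTopBox

end
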